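import Literature.AnabelianGeometry.EtaleTheta.Discharge.Sec2ThetaOrbitClasses
import Literature.AnabelianGeometry.EtaleTheta.DoubleUnderline
import Literature.AnabelianGeometry.EtaleTheta.ThetaLiftUnique

/-!
# [EtTh] §1: the deck transformations of `Ÿ → Y` move the étale theta class by a class of square `1`
# (the class-level sign clause `(P14ii-cl)`, from Prop. 1.5 (iii) at `a = 0`)

Mochizuki, *The étale theta function …* [EtTh], Publ. RIMS **45** (2009), §1, Prop. 1.5 (iii), PRIMS
PDF p. 23 [cite: MochizukiEtTh2009, Prop 1.5 (iii) p.23]; cf. Prop. 1.4 (ii) p. 21 ("`Θ̈(−Ü) = −Θ̈(Ü)`")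
and Rmk. 1.9.1 p. 29 ("`ε_μ`, `ε_±` map `η̈^{Θ,Z} ↦ −η̈^{Θ,Z}`"). PROOF-ONLY companion (0 definitions)
of `ThetaCohomology.lean` by its typer (seat abc-iut-L2-t1, layer L2 of the abc-iut cell).

WHAT IS PROVED. The named fact `Prop15iii` of abc-iut-L2-t1 types "on which `a ∈ Z ≅ Π^tp_X/Π^tp_Y`
acts as follows: `η̈^Θ ↦ η̈^Θ − 2a·log(Ü) − (a²/2)·log(q_X) + log(O^×_K̈)`" as a statement about EVERY
`σ ∈ Π^tp_X` with image `a`. For `σ = ε ∈ Π^tp_Y` (`a = 0`) it says that `ε` moves (the canonical lift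
of) a theta class `x ∈ O^×_K̈ · η̈^Θ` by the Kummer class of a UNIT `u_ε ∈ O^×_K̈`
(`exists_unit_conj_eq_of_mem_GtpY`). Under the standing assumption "`K = K̈`" of §2 (Def. 2.5;
`Sec2Hyps`, abc-iut-L2-t8) that Kummer class comes from `(Π^tp_Y)^Θ`, on whose cohomology `ε` acts
innerly, hence is `ε`-INVARIANT (`conj_inflTheta_kumYdd_eq_self`); and `ε² ∈ Π^tp_Ÿ`
(`[Π^tp_Y : Π^tp_Ÿ] = 2`, abc-iut-L2-t8's `relIndex_GtpYdd_GtpY`) acts trivially on `H¹(Π^tp_Ÿ, Δ_Θ)`.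
The involution argument `x = ε²·x = x·κ₁²` then gives:

* `exists_sq_eq_one_and_conj_eq` — `∃ κ₁, κ₁² = 1 ∧ ε·x = x·κ₁` for every `ε ∈ Π^tp_Y` and every theta
  class `x` — VERBATIM the class-level input `(P14ii-cl)`/`hsign` of the cone node [IUTchII] Prop. 2.2
  (ii) (plan/GAP-LEDGER G-w4d010-2 (R2); abc-iut-L2-t8's `hsign_of_etaDd_sign` binder `h14` with
  `x := E.etaDd`), obtained here from the FACT-LIST fact `Prop15iii` and `K = K̈` ALONE;
* `exists_unit_sq_eq_one_and_conj_eq` — the same with the sign exhibited as the Kummer class of a unit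
  `u ∈ O^×_K̈` with `u² = 1`, i.e. `u = ±1` (`coe_eq_one_or_eq_neg_one_of_sq_eq_one`): for the
  nontrivial deck transformation this is the class-level shadow of "`Θ̈(−Ü) = −Θ̈(Ü)`" (Prop. 1.4 (ii));
  WHICH sign occurs is not decided by `Prop15iii` (the printed `+ log(O^×_K̈)` indeterminacy).

NOT covered (honest residual of (R2)): the INVERSION automorphism `ι` ("fixes `η̈^Θ + log(O^×_K̈)`, but
maps `log(Ü) + log(O^×_K̈)` to `−(log(Ü) + log(O^×_K̈))`", Prop. 1.5 (iii), last clause — recorded NOT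
TYPED in `ThetaCohomology.lean`): `ι` is not an element of `Π^tp_X`, so `Prop15iii` says nothing about it.
Binders: `hC : D.Compat` (a theorem, `Sec1CompatHolds`), `hS : D.Sec2Hyps` (`K = K̈`), `h15 : Prop15iii`.
No new `def … : Prop`, no `sorry`, axioms standard. HONEST FRAMING: [EtTh] is refereed and undisputed;
typed ≠ proved; nothing here takes a side on [IUTchIII] Cor. 3.12.
-/

noncomputable section

namespace Literature.AnabelianGeometry.EtaleTheta

open Literature.AnabelianGeometry.SemiGraphs
open scoped IsMulCommutative

namespace ThetaSetting

variable {p : ℕ} [Fact p.Prime] {D : ThetaSetting p}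

/-- `Π^tp_Y = Ker(Π^tp_X ↠ Z)` is normal (used via `haveI`). [cite: MochizukiEtTh2009, §1 p.12] -/
theorem GtpY_normal : D.GtpY.Normal := inferInstanceAs D.toZ.ker.Normal

/-- **`ε² ∈ Π^tp_Ÿ` for `ε ∈ Π^tp_Y`** under `K = K̈`: `[Π^tp_Y : Π^tp_Ÿ] = 2` (abc-iut-L2-t8's
`relIndex_GtpYdd_GtpY`, from "`Δ^tp_Y/Δ^tp_{Y₂} ≅ ℤ/2ℤ(1)`", p. 16), and squares lie in a subgroup of
index `2`. [cite: MochizukiEtTh2009, §1 p.17] -/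
theorem mul_self_mem_GtpYdd (hS : D.Sec2Hyps) {ε : D.PiTemp} (hε : ε ∈ D.GtpY) : ε * ε ∈ D.GtpYdd := by
  have h2 : (D.GtpYdd.subgroupOf D.GtpY).index = 2 := relIndex_GtpYdd_GtpY hS
  have := Subgroup.mul_self_mem_of_index_two h2 ⟨ε, hε⟩
  rw [Subgroup.mem_subgroupOf] at this
  exact this

/-- An element of `O^×_K̈` whose square is `1` is `±1` (as an element of `ℚ̄_p`).
[cite: MochizukiEtTh2009, Prop 1.4 (ii) p.21] -/
theorem coe_eq_one_or_eq_neg_one_of_sq_eq_one {u : (↥D.Kdd)ˣ} (hu : u ^ 2 = 1) :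
    ((u : D.Kdd) : PadicAlgCl p) = 1 ∨ ((u : D.Kdd) : PadicAlgCl p) = -1 := by
  have h : (((u : D.Kdd) : PadicAlgCl p)) ^ 2 = 1 := by
    have := congrArg (fun v : (↥D.Kdd)ˣ => ((v : D.Kdd) : PadicAlgCl p)) hu
    simpa using this
  exact sq_eq_one_iff.mp h

namespace KummerData

variable (E : D.KummerData)

/-- **Under `K = K̈`, the classes `infl(log(w))`, `w ∈ K̈^×`, on `Π^tp_Ÿ` are fixed by every `ε ∈ Π^tp_Y`:**
`log(w) = log(w')|_{(Π^tp_Ÿ)^Θ}` for a class `log(w')` on `(Π^tp_Y)^Θ` (`exists_kumYdd_eq_res`), so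
`infl(log(w)) = (infl_Y log(w'))|_{Π^tp_Ÿ}`, and `ε ∈ Π^tp_Y` acts innerly — hence trivially — on
`H¹(Π^tp_Y, Δ_Θ)` (`ContH1.conj_eq_self_of_mem`), compatibly with restriction (`res_conj`).
[cite: MochizukiEtTh2009, Prop 1.5 (iii) p.23] -/
theorem conj_inflTheta_kumYdd_eq_self (hC : D.Compat) (hS : D.Sec2Hyps) {ε : D.PiTemp}
    (hε : ε ∈ D.GtpY) (w : (↥D.Kdd)ˣ) :
    haveI := hC.GtpYdd_normal
    ContH1.conj D.toTheta D.DeltaTheta ε (D.inflTheta D.GtpYdd (E.kumYdd (E.toKddHat w))) =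
      D.inflTheta D.GtpYdd (E.kumYdd (E.toKddHat w)) := by
  haveI := hC.GtpYdd_normal
  haveI : D.GtpY.Normal := GtpY_normal
  obtain ⟨k, hk⟩ := E.exists_kumYdd_eq_res hS w
  have hinfl : D.inflTheta D.GtpYdd (E.kumYdd (E.toKddHat w)) =
      ContH1.res D.toTheta D.DeltaTheta D.GtpYdd_le_GtpY (D.inflTheta D.GtpY (E.kumY k)) := by
    rw [hk]
    exact (ContH1.infl_res (H₀ := D.GtpYdd) (H₁ := D.GtpY) (H' := D.GtpYdd.map D.toTheta)
      (H'' := D.GtpY.map D.toTheta) (hψ := D.continuous_toTheta) D.GtpYdd_le_GtpY D.GtpYddTheta_le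
      le_rfl le_rfl _).symm
  rw [hinfl, ← ContH1.res_conj, ContH1.conj_eq_self_of_mem ε hε]

end KummerData

namespace EtaleThetaData

variable (E : D.EtaleThetaData)

/-- **Prop. 1.5 (iii) at `a = 0`**: an element `ε ∈ Π^tp_Y` moves a theta class `x ∈ O^×_K̈ · η̈^Θ` by the
(inflated) Kummer class of a UNIT: `ε·x = x · infl(log(u))`, `u ∈ O^×_K̈` (the `log(Ü)`- and
`log(q̈)`-terms of the printed formula vanish for `a = 0`). [cite: MochizukiEtTh2009, Prop 1.5 (iii) p.23] -/
theorem exists_unit_conj_eq_of_mem_GtpY (hC : D.Compat) (h15 : Prop15iii E hC) {ε : D.PiTemp}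
    (hε : ε ∈ D.GtpY) {x : D.H1 D.GtpYdd} (hx : x ∈ E.thetaClasses) :
    ∃ u ∈ D.unitsOKdd,
      haveI := hC.GtpYdd_normal
      ContH1.conj D.toTheta D.DeltaTheta ε x = x * D.inflTheta D.GtpYdd (E.kumYdd (E.toKddHat u)) := by
  haveI := hC.GtpYdd_normal
  haveI := hC.GtpYddTheta_normal
  obtain ⟨x', ⟨hx', -, hΦ⟩, -⟩ := h15 x hx
  obtain ⟨u, hu, h⟩ := hΦ ε
  have ha : Multiplicative.toAdd (D.toZ ε) = 0 := by
    have : D.toZ ε = 1 := hε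
    rw [this, toAdd_one]
  rw [ha] at h
  simp only [mul_zero, neg_zero, zpow_zero, mul_one] at h
  refine ⟨u, hu, ?_⟩
  have e1 : ContH1.conj D.toTheta D.DeltaTheta ε x =
      D.inflTheta D.GtpYdd (ContH1.conj (MonoidHom.id D.GtpTheta) D.DeltaTheta (D.toTheta ε) x') := by
    rw [← hx']
    exact (ContH1.infl_conj (H₀ := D.GtpYdd) (H' := D.GtpYdd.map D.toTheta)
      (hψ := D.continuous_toTheta) le_rfl ε x').symm
  rw [e1, h, map_mul, hx']

/-- **`(P14ii-cl)` with the sign as a unit**: under `K = K̈`, for `ε ∈ Π^tp_Y` and a theta class `x`, there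
is a unit `u ∈ O^×_K̈` with `u² = 1` (so `u = ±1`, `coe_eq_one_or_eq_neg_one_of_sq_eq_one`) and
`ε·x = x·infl(log(u))` — the class-level shadow of "`Θ̈(−Ü) = −Θ̈(Ü)`" (Prop. 1.4 (ii)) for the
nontrivial deck transformation of `Ÿ → Y`, from Prop. 1.5 (iii) and the involution argument
(`ε² ∈ Π^tp_Ÿ` acts trivially; `infl(log(u))` is `ε`-invariant; the Kummer maps are injective).
[cite: MochizukiEtTh2009, Prop 1.5 (iii) p.23] -/
theorem exists_unit_sq_eq_one_and_conj_eq (hC : D.Compat) (hS : D.Sec2Hyps) (h15 : Prop15iii E hC)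
    {ε : D.PiTemp} (hε : ε ∈ D.GtpY) {x : D.H1 D.GtpYdd} (hx : x ∈ E.thetaClasses) :
    ∃ u ∈ D.unitsOKdd, u ^ 2 = 1 ∧
      haveI := hC.GtpYdd_normal
      ContH1.conj D.toTheta D.DeltaTheta ε x = x * D.inflTheta D.GtpYdd (E.kumYdd (E.toKddHat u)) := by
  haveI := hC.GtpYdd_normal
  obtain ⟨u, hu, h⟩ := E.exists_unit_conj_eq_of_mem_GtpY hC h15 hε hx
  refine ⟨u, hu, ?_, h⟩
  set κ := D.inflTheta D.GtpYdd (E.kumYdd (E.toKddHat u)) with hκ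
  -- `ε²` acts trivially, `κ` is `ε`-invariant: `x = x κ κ`
  have hfix : ContH1.conj D.toTheta D.DeltaTheta ε κ = κ :=
    E.toKummerData.conj_inflTheta_kumYdd_eq_self hC hS hε u
  have h2 : x = x * κ * κ := by
    conv_lhs => rw [← ContH1.conj_eq_self_of_mem (φ := D.toTheta) (A := D.DeltaTheta)
      (ε * ε) (mul_self_mem_GtpYdd hS hε) x, ContH1.conj_mul_apply, h, map_mul, h, hfix]
  have hκ2 : κ ^ 2 = 1 := by
    have h3 : x * (κ * κ) = x * 1 := by rw [mul_one, ← mul_assoc]; exact h2.symm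
    rw [sq]
    exact mul_left_cancel h3
  -- `infl ∘ kumYdd ∘ toKddHat` is injective
  have hinj : (D.inflTheta D.GtpYdd) (E.kumYdd (E.toKddHat (u ^ 2))) =
      (D.inflTheta D.GtpYdd) (E.kumYdd (E.toKddHat 1)) := by
    rw [map_pow, map_pow, map_pow, ← hκ, hκ2, map_one, map_one, map_one]
  exact E.toKddHat_injective (E.kumYdd_injective (D.inflTheta_injective D.GtpYdd hinj))

/-- **`(P14ii-cl)` / the binder `hsign`**: under `K = K̈`, every `ε ∈ Π^tp_Y` moves every theta class
`x ∈ O^×_K̈ · η̈^Θ ⊆ H¹(Π^tp_Ÿ, Δ_Θ)` by a class of square one: `∃ κ₁, κ₁² = 1 ∧ ε·x = x·κ₁` — from the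
named fact `Prop15iii` alone (VERBATIM the hypothesis `h14` of abc-iut-L2-t8's `hsign_of_etaDd_sign`
for `x := E.etaDd`, `etaDd_mem_thetaClasses`). [cite: MochizukiEtTh2009, Prop 1.5 (iii) p.23] -/
theorem exists_sq_eq_one_and_conj_eq (hC : D.Compat) (hS : D.Sec2Hyps) (h15 : Prop15iii E hC)
    {ε : D.PiTemp} (hε : ε ∈ D.GtpY) {x : D.H1 D.GtpYdd} (hx : x ∈ E.thetaClasses) :
    ∃ κ₁ : D.H1 D.GtpYdd, κ₁ ^ 2 = 1 ∧
      haveI := hC.GtpYdd_normal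
      ContH1.conj D.toTheta D.DeltaTheta ε x = x * κ₁ := by
  obtain ⟨u, -, hu2, h⟩ := E.exists_unit_sq_eq_one_and_conj_eq hC hS h15 hε hx
  exact ⟨_, by rw [← map_pow, ← map_pow, ← map_pow, hu2, map_one, map_one, map_one], h⟩

/-- The sign class lies in the Kummer classes of units `log(O^×_K̈)` (so `ε` permutes the set
`O^×_K̈ · η̈^Θ` of theta classes). [cite: MochizukiEtTh2009, Prop 1.5 (iii) p.23] -/
theorem conj_mem_thetaClasses_of_mem_GtpY (hC : D.Compat) (h15 : Prop15iii E hC) {ε : D.PiTemp}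
    (hε : ε ∈ D.GtpY) {x : D.H1 D.GtpYdd} (hx : x ∈ E.thetaClasses) :
    haveI := hC.GtpYdd_normal
    ContH1.conj D.toTheta D.DeltaTheta ε x ∈ E.thetaClasses := by
  haveI := hC.GtpYdd_normal
  obtain ⟨u, hu, h⟩ := E.exists_unit_conj_eq_of_mem_GtpY hC h15 hε hx
  obtain ⟨k, hk, rfl⟩ := hx
  refine ⟨D.inflTheta D.GtpYdd (E.kumYdd (E.toKddHat u)) * k, mul_mem ⟨_, ⟨u, hu, rfl⟩, rfl⟩ hk, ?_⟩
  rw [h]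
  simp only [mul_assoc, mul_comm, mul_left_comm]

/-- **The `ε`-action on theta classes is an involution with unit sign `±1` at `η̈^Θ` itself**: under
`K = K̈`, for `ε ∈ Π^tp_Y` there is `u ∈ O^×_K̈`, `u = ±1` in `ℚ̄_p`, with `ε·η̈^Θ = log(u) + η̈^Θ`
(additively) — cf. Rmk. 1.9.1 "`ε_μ`, `ε_±` map `η̈^{Θ,Z} ↦ −η̈^{Θ,Z}`". [cite: MochizukiEtTh2009, Rmk 1.9.1 p.29] -/
theorem exists_pmOne_conj_etaDd_eq (hC : D.Compat) (hS : D.Sec2Hyps) (h15 : Prop15iii E hC)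
    {ε : D.PiTemp} (hε : ε ∈ D.GtpY) :
    ∃ u ∈ D.unitsOKdd, (((u : D.Kdd) : PadicAlgCl p) = 1 ∨ ((u : D.Kdd) : PadicAlgCl p) = -1) ∧
      haveI := hC.GtpYdd_normal
      ContH1.conj D.toTheta D.DeltaTheta ε E.etaDd =
        E.etaDd * D.inflTheta D.GtpYdd (E.kumYdd (E.toKddHat u)) := by
  obtain ⟨u, hu, hu2, h⟩ :=
    E.exists_unit_sq_eq_one_and_conj_eq hC hS h15 hε E.etaDd_mem_thetaClasses
  exact ⟨u, hu, coe_eq_one_or_eq_neg_one_of_sq_eq_one hu2, h⟩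

end EtaleThetaData

end ThetaSetting

end Literature.AnabelianGeometry.EtaleTheta

end
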